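import Mathlib
import Literature.MathematicalPhysics.QuantumLattice.WilsonDiracAP
import Summits.QuantumFields.QCD.Theorems.QuarksAsStableActionCriticalLineDiamagnetismStubBilinearBounds
import Summits.QuantumFields.QCD.Theorems.QuarksAsStableActionCriticalLineDiamagnetismStubUnitaryCellIneq

/-!
# Mass dependence of the block Hessian (resolvent identity and Frobenius bounds)
(helper for crux stmt-QuantumFields-9734, line `Sketch`, stub `stub_massLipschitz`)

What.  On the `2⁴` block `(ℤ/2)⁴` (colour `Fin 3`, spin `Fin 4`; index type
`TorusSite 4 2 × Fin 3 × Fin 4`, `192`-dimensional) let `B_m = wilsonDirac ρ₃ (fun e => u e.2) m 1`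
and `B_z` (the same at mass `0`) be the free `r = 1` Wilson–Dirac operators with constant
direction-dependent unitary links `u_μ ∈ U(3)`, and let `Δ(E)` be the hopping perturbation
(ℝ-linear in the matrix-valued link field `E : Edge 4 2 → M₃(ℂ)`).  The block Hessian at `B` is
`Q_B(Y) = ½ Re tr (B⁻¹ Δ(Y) B⁻¹ Δ(Y)) − ½ Re tr (B⁻¹ Δ(Y ⋆ Y))`, `(Y ⋆ Y)_e = Y_e Y_e`.  If `B_m` is
coercive with constant `c_m > 0` and `B_z` with `c_0 > 0`, then (`stub_massLipschitz`)
`|Q_{B_m}(Y) − Q_{B_z}(Y)| ≤ |m| · (16/(c_m √c_0) + 16/(c_0 √c_m) + 40/(√c_m √c_0)) · ‖Y‖²`,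
`‖Y‖² = Σ_e Σ_{ab} ‖Y_e a b‖²`.

How.  `B_m = B_z + m · 1` (the mass enters the Wilson–Dirac operator only through the diagonal),
so by the resolvent identity `B_m⁻¹ − B_z⁻¹ = −m B_m⁻¹ B_z⁻¹` (both invertible by coercivity,
`StubDetPerturbIRAux.det_ne_zero_of_coercive`, `Matrix.inv_sub_inv`).  With `P_i = B_i⁻¹ Δ`,
`P_m P_m − P_z P_z = (P_m − P_z) P_m + P_z (P_m − P_z)` and `P_m − P_z = −m B_m⁻¹ P_z`; every trace
is estimated by `|Re tr (P Q)| ≤ ‖P‖_F ‖Q‖_F` (`BilinearBounds.abs_re_trace_mul_le`) and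
`‖B⁻¹ X‖_F ≤ ‖X‖_F / √c` (`BlockEstimate.frob_inv_mul_le`), giving the bubble part
`|m| (1/(c_m √c_0) + 1/(c_0 √c_m)) ‖Δ(Y)‖_F²`; the tadpole part is
`|m| |Re tr (B_m⁻¹ B_z⁻¹ Δ₂)| ≤ |m| ‖B_m⁻¹‖_F ‖B_z⁻¹ Δ₂‖_F ≤ |m| √(192/c_m) ‖Δ₂‖_F / √c_0`.
Finally `‖Δ(Y)‖_F² ≤ 32 ‖Y‖²` (`BilinearBounds.hop_frob_le`) and
`‖Δ(Y ⋆ Y)‖_F² ≤ 32 Σ_e ‖Y_e Y_e‖_F² ≤ 32 (‖Y‖²)²` (`UnitaryCellIneq.frob_mul_le`), and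
`√192 · √32 = √6144 ≤ 80`.

Sources.  Folklore finite-dimensional linear algebra (second resolvent identity, Frobenius norm,
Cauchy–Schwarz); Montvay–Münster, *Quantum Fields on a Lattice* §4.2 (Wilson fermions).  Pure
theorem file (no `def`s); pattern: sibling `…StubBilinearBounds`.
-/

noncomputable section

open scoped BigOperators Classical Matrix ComplexConjugate
open Finset
open Literature.MathematicalPhysics.QuantumLattice Literature.MathematicalPhysics.QuantumFieldTheory
  Literature.Probability.LatticeModels

namespace Summit.QuantumFields.QCD.Cruxes.CriticalLineDiamagnetism.ChessboardCellGain

namespace MassLipschitz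

open StubDetPerturbIRAux BlockEstimate BilinearBounds

/-! ### Generic linear algebra: resolvent identity and Frobenius estimates for coercive matrices -/

section Generic

variable {ι : Type} [Fintype ι] [DecidableEq ι]

/-- **Resolvent identity.**  If `B₁ = B₂ + m · 1` and both determinants are nonzero, then
`B₁⁻¹ − B₂⁻¹ = −m B₁⁻¹ B₂⁻¹`. -/
theorem resolvent_sub (B₁ B₂ : Matrix ι ι ℂ) (m : ℝ) (h₁ : B₁.det ≠ 0) (h₂ : B₂.det ≠ 0)
    (hm : B₁ = B₂ + (m : ℂ) • 1) :
    B₁⁻¹ - B₂⁻¹ = -((m : ℂ) • (B₁⁻¹ * B₂⁻¹)) := by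
  have hU₁ : IsUnit B₁ := (Matrix.isUnit_iff_isUnit_det _).mpr (isUnit_iff_ne_zero.mpr h₁)
  have hU₂ : IsUnit B₂ := (Matrix.isUnit_iff_isUnit_det _).mpr (isUnit_iff_ne_zero.mpr h₂)
  have hdiff : B₂ - B₁ = -((m : ℂ) • (1 : Matrix ι ι ℂ)) := by
    rw [hm]; abel
  rw [Matrix.inv_sub_inv (iff_of_true hU₁ hU₂), hdiff, Matrix.mul_neg, Matrix.neg_mul,
    Matrix.mul_smul, Matrix.mul_one, Matrix.smul_mul]

/-- Square-root form of the coercive inverse bound: `‖B⁻¹ X‖_F ≤ ‖X‖_F / √c`. -/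
theorem sqrt_frob_inv_mul_le (B X : Matrix ι ι ℂ) {c : ℝ} (hc : 0 < c)
    (hB : ∀ v : ι → ℂ, c * ∑ i, ‖v i‖ ^ 2 ≤ ∑ i, ‖(B.mulVec v) i‖ ^ 2) :
    Real.sqrt (∑ i, ∑ j, ‖(B⁻¹ * X) i j‖ ^ 2) ≤
      Real.sqrt (∑ i, ∑ j, ‖X i j‖ ^ 2) / Real.sqrt c := by
  rw [← Real.sqrt_div' _ hc.le]
  exact Real.sqrt_le_sqrt (frob_inv_mul_le B X hc hB)

/-- The Frobenius sum of the identity matrix is the dimension. -/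
theorem frob_one_eq_card : ∑ i, ∑ j, ‖(1 : Matrix ι ι ℂ) i j‖ ^ 2 = Fintype.card ι := by
  have h : ∀ i j : ι, ‖(1 : Matrix ι ι ℂ) i j‖ ^ 2 = if i = j then (1 : ℝ) else 0 := fun i j => by
    by_cases hij : i = j <;> simp [Matrix.one_apply, hij]
  simp only [h, Finset.sum_ite_eq, Finset.mem_univ, if_true, Finset.sum_const, Finset.card_univ,
    nsmul_eq_mul, mul_one]

/-- Frobenius bound on the inverse of a coercive matrix: `‖B⁻¹‖_F ≤ √n / √c`. -/
theorem sqrt_frob_inv_le (B : Matrix ι ι ℂ) {c : ℝ} (hc : 0 < c)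
    (hB : ∀ v : ι → ℂ, c * ∑ i, ‖v i‖ ^ 2 ≤ ∑ i, ‖(B.mulVec v) i‖ ^ 2) :
    Real.sqrt (∑ i, ∑ j, ‖B⁻¹ i j‖ ^ 2) ≤ Real.sqrt (Fintype.card ι) / Real.sqrt c := by
  have h := sqrt_frob_inv_mul_le B 1 hc hB
  rwa [Matrix.mul_one, frob_one_eq_card] at h

/-- **Bubble part.**  For coercive `B₁`, `B₂` (constants `c₁`, `c₂`) with
`B₁⁻¹ − B₂⁻¹ = −m B₁⁻¹ B₂⁻¹`:
`|Re tr (B₁⁻¹Δ B₁⁻¹Δ) − Re tr (B₂⁻¹Δ B₂⁻¹Δ)| ≤ |m| (1/(c₁ √c₂) + 1/(c₂ √c₁)) ‖Δ‖_F²`. -/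
theorem bubble_sub_le (B₁ B₂ Δ : Matrix ι ι ℂ) {c₁ c₂ : ℝ} (m : ℝ) (hc₁ : 0 < c₁) (hc₂ : 0 < c₂)
    (hB₁ : ∀ v : ι → ℂ, c₁ * ∑ i, ‖v i‖ ^ 2 ≤ ∑ i, ‖(B₁.mulVec v) i‖ ^ 2)
    (hB₂ : ∀ v : ι → ℂ, c₂ * ∑ i, ‖v i‖ ^ 2 ≤ ∑ i, ‖(B₂.mulVec v) i‖ ^ 2)
    (hR : B₁⁻¹ - B₂⁻¹ = -((m : ℂ) • (B₁⁻¹ * B₂⁻¹))) :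
    |(B₁⁻¹ * Δ * (B₁⁻¹ * Δ)).trace.re - (B₂⁻¹ * Δ * (B₂⁻¹ * Δ)).trace.re| ≤
      |m| * (1 / (c₁ * Real.sqrt c₂) + 1 / (c₂ * Real.sqrt c₁)) * ∑ i, ∑ j, ‖Δ i j‖ ^ 2 := by
  set P₁ : Matrix ι ι ℂ := B₁⁻¹ * Δ with hP₁
  set P₂ : Matrix ι ι ℂ := B₂⁻¹ * Δ with hP₂
  -- algebra: `P₁P₁ − P₂P₂ = (P₁ − P₂)P₁ + P₂(P₁ − P₂)` and `P₁ − P₂ = −m B₁⁻¹ P₂`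
  have hdP : P₁ - P₂ = -((m : ℂ) • (B₁⁻¹ * P₂)) := by
    rw [hP₁, hP₂, ← Matrix.sub_mul, hR, Matrix.neg_mul, Matrix.smul_mul, Matrix.mul_assoc]
  have halg : P₁ * P₁ - P₂ * P₂ = -((m : ℂ) • (B₁⁻¹ * P₂ * P₁ + P₂ * (B₁⁻¹ * P₂))) := by
    have h : P₁ * P₁ - P₂ * P₂ = (P₁ - P₂) * P₁ + P₂ * (P₁ - P₂) := by
      rw [Matrix.sub_mul, Matrix.mul_sub]; abel
    rw [h, hdP, Matrix.neg_mul, Matrix.mul_neg, Matrix.smul_mul, Matrix.mul_smul, smul_add,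
      neg_add]
  have htr : (P₁ * P₁).trace.re - (P₂ * P₂).trace.re =
      -(m * ((B₁⁻¹ * P₂ * P₁).trace.re + (P₂ * (B₁⁻¹ * P₂)).trace.re)) := by
    rw [← Complex.sub_re, ← Matrix.trace_sub, halg, Matrix.trace_neg, Matrix.trace_smul,
      Matrix.trace_add, smul_eq_mul, Complex.neg_re, Complex.re_ofReal_mul, Complex.add_re]
  -- Frobenius norms
  have hd0 : 0 ≤ ∑ i, ∑ j, ‖Δ i j‖ ^ 2 := by positivity
  have hnP₁ : Real.sqrt (∑ i, ∑ j, ‖P₁ i j‖ ^ 2) ≤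
      Real.sqrt (∑ i, ∑ j, ‖Δ i j‖ ^ 2) / Real.sqrt c₁ := sqrt_frob_inv_mul_le B₁ Δ hc₁ hB₁
  have hnP₂ : Real.sqrt (∑ i, ∑ j, ‖P₂ i j‖ ^ 2) ≤
      Real.sqrt (∑ i, ∑ j, ‖Δ i j‖ ^ 2) / Real.sqrt c₂ := sqrt_frob_inv_mul_le B₂ Δ hc₂ hB₂
  have hnSP₂ : Real.sqrt (∑ i, ∑ j, ‖(B₁⁻¹ * P₂) i j‖ ^ 2) ≤
      Real.sqrt (∑ i, ∑ j, ‖Δ i j‖ ^ 2) / Real.sqrt c₂ / Real.sqrt c₁ :=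
    (sqrt_frob_inv_mul_le B₁ P₂ hc₁ hB₁).trans
      (div_le_div_of_nonneg_right hnP₂ (Real.sqrt_nonneg _))
  have hsq : Real.sqrt (∑ i, ∑ j, ‖Δ i j‖ ^ 2) * Real.sqrt (∑ i, ∑ j, ‖Δ i j‖ ^ 2) =
      ∑ i, ∑ j, ‖Δ i j‖ ^ 2 := Real.mul_self_sqrt hd0
  have hs₁ : Real.sqrt c₁ * Real.sqrt c₁ = c₁ := Real.mul_self_sqrt hc₁.le
  have hs₂ : Real.sqrt c₂ * Real.sqrt c₂ = c₂ := Real.mul_self_sqrt hc₂.le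
  -- the two traces
  have ha : |(B₁⁻¹ * P₂ * P₁).trace.re| ≤ (∑ i, ∑ j, ‖Δ i j‖ ^ 2) / (c₁ * Real.sqrt c₂) :=
    calc |(B₁⁻¹ * P₂ * P₁).trace.re|
        ≤ Real.sqrt (∑ i, ∑ j, ‖(B₁⁻¹ * P₂) i j‖ ^ 2) * Real.sqrt (∑ i, ∑ j, ‖P₁ i j‖ ^ 2) :=
          abs_re_trace_mul_le _ _
      _ ≤ Real.sqrt (∑ i, ∑ j, ‖Δ i j‖ ^ 2) / Real.sqrt c₂ / Real.sqrt c₁ *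
            (Real.sqrt (∑ i, ∑ j, ‖Δ i j‖ ^ 2) / Real.sqrt c₁) :=
          mul_le_mul hnSP₂ hnP₁ (Real.sqrt_nonneg _) (by positivity)
      _ = Real.sqrt (∑ i, ∑ j, ‖Δ i j‖ ^ 2) * Real.sqrt (∑ i, ∑ j, ‖Δ i j‖ ^ 2) /
            (Real.sqrt c₁ * Real.sqrt c₁ * Real.sqrt c₂) := by ring
      _ = (∑ i, ∑ j, ‖Δ i j‖ ^ 2) / (c₁ * Real.sqrt c₂) := by rw [hsq, hs₁]
  have hb : |(P₂ * (B₁⁻¹ * P₂)).trace.re| ≤ (∑ i, ∑ j, ‖Δ i j‖ ^ 2) / (c₂ * Real.sqrt c₁) :=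
    calc |(P₂ * (B₁⁻¹ * P₂)).trace.re|
        ≤ Real.sqrt (∑ i, ∑ j, ‖P₂ i j‖ ^ 2) * Real.sqrt (∑ i, ∑ j, ‖(B₁⁻¹ * P₂) i j‖ ^ 2) :=
          abs_re_trace_mul_le _ _
      _ ≤ Real.sqrt (∑ i, ∑ j, ‖Δ i j‖ ^ 2) / Real.sqrt c₂ *
            (Real.sqrt (∑ i, ∑ j, ‖Δ i j‖ ^ 2) / Real.sqrt c₂ / Real.sqrt c₁) :=
          mul_le_mul hnP₂ hnSP₂ (Real.sqrt_nonneg _) (by positivity)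
      _ = Real.sqrt (∑ i, ∑ j, ‖Δ i j‖ ^ 2) * Real.sqrt (∑ i, ∑ j, ‖Δ i j‖ ^ 2) /
            (Real.sqrt c₂ * Real.sqrt c₂ * Real.sqrt c₁) := by ring
      _ = (∑ i, ∑ j, ‖Δ i j‖ ^ 2) / (c₂ * Real.sqrt c₁) := by rw [hsq, hs₂]
  rw [htr, abs_neg, abs_mul]
  calc |m| * |(B₁⁻¹ * P₂ * P₁).trace.re + (P₂ * (B₁⁻¹ * P₂)).trace.re|
      ≤ |m| * ((∑ i, ∑ j, ‖Δ i j‖ ^ 2) / (c₁ * Real.sqrt c₂) +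
          (∑ i, ∑ j, ‖Δ i j‖ ^ 2) / (c₂ * Real.sqrt c₁)) :=
        mul_le_mul_of_nonneg_left ((abs_add_le _ _).trans (add_le_add ha hb)) (abs_nonneg m)
    _ = |m| * (1 / (c₁ * Real.sqrt c₂) + 1 / (c₂ * Real.sqrt c₁)) * ∑ i, ∑ j, ‖Δ i j‖ ^ 2 := by
        ring

/-- **Tadpole part.**  For coercive `B₁`, `B₂` (constants `c₁`, `c₂`) with
`B₁⁻¹ − B₂⁻¹ = −m B₁⁻¹ B₂⁻¹`:
`|Re tr (B₁⁻¹ Δ₂) − Re tr (B₂⁻¹ Δ₂)| ≤ |m| (√n/(√c₁ √c₂)) ‖Δ₂‖_F`. -/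
theorem tadpole_sub_le (B₁ B₂ Δ₂ : Matrix ι ι ℂ) {c₁ c₂ : ℝ} (m : ℝ) (hc₁ : 0 < c₁)
    (hc₂ : 0 < c₂)
    (hB₁ : ∀ v : ι → ℂ, c₁ * ∑ i, ‖v i‖ ^ 2 ≤ ∑ i, ‖(B₁.mulVec v) i‖ ^ 2)
    (hB₂ : ∀ v : ι → ℂ, c₂ * ∑ i, ‖v i‖ ^ 2 ≤ ∑ i, ‖(B₂.mulVec v) i‖ ^ 2)
    (hR : B₁⁻¹ - B₂⁻¹ = -((m : ℂ) • (B₁⁻¹ * B₂⁻¹))) :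
    |(B₁⁻¹ * Δ₂).trace.re - (B₂⁻¹ * Δ₂).trace.re| ≤
      |m| * (Real.sqrt (Fintype.card ι) / (Real.sqrt c₁ * Real.sqrt c₂)) *
        Real.sqrt (∑ i, ∑ j, ‖Δ₂ i j‖ ^ 2) := by
  have htr : (B₁⁻¹ * Δ₂).trace.re - (B₂⁻¹ * Δ₂).trace.re =
      -(m * (B₁⁻¹ * (B₂⁻¹ * Δ₂)).trace.re) := by
    rw [← Complex.sub_re, ← Matrix.trace_sub, ← Matrix.sub_mul, hR, Matrix.neg_mul,
      Matrix.smul_mul, Matrix.mul_assoc, Matrix.trace_neg, Matrix.trace_smul, smul_eq_mul,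
      Complex.neg_re, Complex.re_ofReal_mul]
  rw [htr, abs_neg, abs_mul]
  calc |m| * |(B₁⁻¹ * (B₂⁻¹ * Δ₂)).trace.re|
      ≤ |m| * (Real.sqrt (∑ i, ∑ j, ‖B₁⁻¹ i j‖ ^ 2) *
          Real.sqrt (∑ i, ∑ j, ‖(B₂⁻¹ * Δ₂) i j‖ ^ 2)) :=
        mul_le_mul_of_nonneg_left (abs_re_trace_mul_le _ _) (abs_nonneg m)
    _ ≤ |m| * (Real.sqrt (Fintype.card ι) / Real.sqrt c₁ *
          (Real.sqrt (∑ i, ∑ j, ‖Δ₂ i j‖ ^ 2) / Real.sqrt c₂)) :=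
        mul_le_mul_of_nonneg_left
          (mul_le_mul (sqrt_frob_inv_le B₁ hc₁ hB₁) (sqrt_frob_inv_mul_le B₂ Δ₂ hc₂ hB₂)
            (Real.sqrt_nonneg _) (by positivity))
          (abs_nonneg m)
    _ = |m| * (Real.sqrt (Fintype.card ι) / (Real.sqrt c₁ * Real.sqrt c₂)) *
          Real.sqrt (∑ i, ∑ j, ‖Δ₂ i j‖ ^ 2) := by ring

/-- Halving and the triangle inequality: `|a − a'| ≤ X`, `|t − t'| ≤ T` give
`|(a/2 − t/2) − (a'/2 − t'/2)| ≤ X/2 + T/2`. -/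
theorem abs_half_sub_half_le {a a' t t' X T : ℝ} (ha : |a - a'| ≤ X) (ht : |t - t'| ≤ T) :
    |(a / 2 - t / 2) - (a' / 2 - t' / 2)| ≤ X / 2 + T / 2 := by
  rw [abs_le] at ha ht ⊢
  constructor <;> linarith [ha.1, ha.2, ht.1, ht.2]

/-- `√192 · √32 ≤ 80` (`192 · 32 = 6144 ≤ 6400`). -/
theorem sqrt_192_mul_sqrt_32_le : Real.sqrt 192 * Real.sqrt 32 ≤ 80 := by
  rw [← Real.sqrt_mul (by norm_num : (0 : ℝ) ≤ 192)]
  exact (Real.sqrt_le_sqrt (by norm_num : (192 : ℝ) * 32 ≤ 80 ^ 2)).trans_eq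
    (Real.sqrt_sq (by norm_num))

/-- **Mass dependence of the Hessian, generic form.**  For `B₁ = B₂ + m · 1` on a
`192`-dimensional space, both coercive (constants `c₁`, `c₂`), and perturbations with
`‖Δ‖_F² ≤ 32 F`, `‖Δ₂‖_F² ≤ 32 F²` (`F ≥ 0`): the Hessians
`Q_i = ½ Re tr (B_i⁻¹Δ B_i⁻¹Δ) − ½ Re tr (B_i⁻¹Δ₂)` satisfy
`|Q₁ − Q₂| ≤ |m| (16/(c₁√c₂) + 16/(c₂√c₁) + 40/(√c₁√c₂)) F`. -/
theorem hessian_sub_le (B₁ B₂ Δ Δ₂ : Matrix ι ι ℂ) {c₁ c₂ F : ℝ} (m : ℝ) (hc₁ : 0 < c₁)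
    (hc₂ : 0 < c₂)
    (hB₁ : ∀ v : ι → ℂ, c₁ * ∑ i, ‖v i‖ ^ 2 ≤ ∑ i, ‖(B₁.mulVec v) i‖ ^ 2)
    (hB₂ : ∀ v : ι → ℂ, c₂ * ∑ i, ‖v i‖ ^ 2 ≤ ∑ i, ‖(B₂.mulVec v) i‖ ^ 2)
    (hm : B₁ = B₂ + (m : ℂ) • 1) (hn : (Fintype.card ι : ℝ) = 192) (hF : 0 ≤ F)
    (hΔ : ∑ i, ∑ j, ‖Δ i j‖ ^ 2 ≤ 32 * F) (hΔ₂ : ∑ i, ∑ j, ‖Δ₂ i j‖ ^ 2 ≤ 32 * F ^ 2) :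
    |((B₁⁻¹ * Δ * (B₁⁻¹ * Δ)).trace.re / 2 - (B₁⁻¹ * Δ₂).trace.re / 2) -
        ((B₂⁻¹ * Δ * (B₂⁻¹ * Δ)).trace.re / 2 - (B₂⁻¹ * Δ₂).trace.re / 2)| ≤
      |m| * (16 / (c₁ * Real.sqrt c₂) + 16 / (c₂ * Real.sqrt c₁) +
        40 / (Real.sqrt c₁ * Real.sqrt c₂)) * F := by
  have hR : B₁⁻¹ - B₂⁻¹ = -((m : ℂ) • (B₁⁻¹ * B₂⁻¹)) :=
    resolvent_sub B₁ B₂ m (det_ne_zero_of_coercive B₁ hc₁ hB₁)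
      (det_ne_zero_of_coercive B₂ hc₂ hB₂) hm
  have hK0 : 0 ≤ |m| * (1 / (c₁ * Real.sqrt c₂) + 1 / (c₂ * Real.sqrt c₁)) := by positivity
  have hL0 : 0 ≤ |m| * (Real.sqrt (Fintype.card ι) / (Real.sqrt c₁ * Real.sqrt c₂)) := by
    positivity
  -- bubble part with `‖Δ‖_F² ≤ 32 F`
  have hbub : |(B₁⁻¹ * Δ * (B₁⁻¹ * Δ)).trace.re - (B₂⁻¹ * Δ * (B₂⁻¹ * Δ)).trace.re| ≤
      |m| * (1 / (c₁ * Real.sqrt c₂) + 1 / (c₂ * Real.sqrt c₁)) * (32 * F) :=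
    (bubble_sub_le B₁ B₂ Δ m hc₁ hc₂ hB₁ hB₂ hR).trans (mul_le_mul_of_nonneg_left hΔ hK0)
  -- tadpole part with `‖Δ₂‖_F ≤ √32 F` and `√192 √32 ≤ 80`
  have hsF : Real.sqrt (∑ i, ∑ j, ‖Δ₂ i j‖ ^ 2) ≤ Real.sqrt 32 * F :=
    (Real.sqrt_le_sqrt hΔ₂).trans_eq
      (by rw [Real.sqrt_mul (by norm_num : (0 : ℝ) ≤ 32), Real.sqrt_sq hF])
  have htad : |(B₁⁻¹ * Δ₂).trace.re - (B₂⁻¹ * Δ₂).trace.re| ≤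
      |m| * (80 / (Real.sqrt c₁ * Real.sqrt c₂)) * F :=
    calc |(B₁⁻¹ * Δ₂).trace.re - (B₂⁻¹ * Δ₂).trace.re|
        ≤ |m| * (Real.sqrt (Fintype.card ι) / (Real.sqrt c₁ * Real.sqrt c₂)) *
            Real.sqrt (∑ i, ∑ j, ‖Δ₂ i j‖ ^ 2) := tadpole_sub_le B₁ B₂ Δ₂ m hc₁ hc₂ hB₁ hB₂ hR
      _ ≤ |m| * (Real.sqrt (Fintype.card ι) / (Real.sqrt c₁ * Real.sqrt c₂)) *
            (Real.sqrt 32 * F) := mul_le_mul_of_nonneg_left hsF hL0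
      _ = |m| * (Real.sqrt 192 * Real.sqrt 32) * (F / (Real.sqrt c₁ * Real.sqrt c₂)) := by
          rw [hn]; ring
      _ ≤ |m| * 80 * (F / (Real.sqrt c₁ * Real.sqrt c₂)) :=
          mul_le_mul_of_nonneg_right
            (mul_le_mul_of_nonneg_left sqrt_192_mul_sqrt_32_le (abs_nonneg m)) (by positivity)
      _ = |m| * (80 / (Real.sqrt c₁ * Real.sqrt c₂)) * F := by ring
  refine (abs_half_sub_half_le hbub htad).trans (le_of_eq ?_)
  ring

end Generic

/-! ### The block: Frobenius sum of the link field `Y ⋆ Y` -/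

/-- `Σ_e ‖Y_e Y_e‖_F² ≤ (Σ_e ‖Y_e‖_F²)²` (Frobenius submultiplicativity link by link, then
`Σ a_e² ≤ (Σ a_e)²` for `a_e ≥ 0`). -/
theorem sum_frob_mul_self_le (Y : Edge 4 2 → Matrix (Fin 3) (Fin 3) ℂ) :
    ∑ e, ∑ a, ∑ b, ‖(Y e * Y e) a b‖ ^ 2 ≤ (∑ e, ∑ a, ∑ b, ‖Y e a b‖ ^ 2) ^ 2 := by
  have h0 : ∀ e : Edge 4 2, 0 ≤ ∑ a, ∑ b, ‖Y e a b‖ ^ 2 := fun e => by positivity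
  calc ∑ e, ∑ a, ∑ b, ‖(Y e * Y e) a b‖ ^ 2
      ≤ ∑ e, (∑ a, ∑ b, ‖Y e a b‖ ^ 2) * ∑ a, ∑ b, ‖Y e a b‖ ^ 2 :=
        Finset.sum_le_sum fun e _ => UnitaryCellIneq.frob_mul_le (Y e) (Y e)
    _ ≤ ∑ e, (∑ a, ∑ b, ‖Y e a b‖ ^ 2) * ∑ e', ∑ a, ∑ b, ‖Y e' a b‖ ^ 2 :=
        Finset.sum_le_sum fun e _ => mul_le_mul_of_nonneg_left
          (Finset.single_le_sum (f := fun e' => ∑ a, ∑ b, ‖Y e' a b‖ ^ 2) (fun e' _ => h0 e')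
            (Finset.mem_univ e)) (h0 e)
    _ = (∑ e, ∑ a, ∑ b, ‖Y e a b‖ ^ 2) ^ 2 := by rw [← Finset.sum_mul, sq]

end MassLipschitz

open MassLipschitz BilinearBounds in
/-- **Stub MgM — `massLipschitz` (mass dependence of the block Hessian).**  On the `2⁴` block with
arbitrary constant unitary direction links `u_μ`, masses `m` and `0` with coercivity constants
`c_m, c_0 > 0` of `B_m = D₂[u](m)`, `B_z = D₂[u](0)`:
`|Q_m(Y) − Q_0(Y)| ≤ |m| · (16/(c_m √c_0) + 16/(c_0 √c_m) + 40/(√c_m √c_0)) · ‖Y‖²` for every link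
field `Y`, `Q(Y) = ½ Re tr (B⁻¹ Δ(Y) B⁻¹ Δ(Y)) − ½ Re tr (B⁻¹ Δ(Y ⋆ Y))`.  Proof:
`B_m = B_z + m · 1`, the resolvent identity, `|Re tr (PQ)| ≤ ‖P‖_F ‖Q‖_F`,
`‖B⁻¹X‖_F ≤ ‖X‖_F/√c`, `‖B⁻¹‖_F ≤ √(192/c)`, `‖Δ(Y)‖_F² ≤ 32 ‖Y‖²`,
`‖Δ(Y ⋆ Y)‖_F ≤ √32 ‖Y‖²`, `√6144 ≤ 80` (`MassLipschitz.hessian_sub_le`). -/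
theorem stub_massLipschitz : ∀ (m : ℝ) (u : Fin 4 → Matrix.unitaryGroup (Fin 3) ℂ) (cm c0 : ℝ), 0 < cm → 0 < c0 → let Bm : Matrix (TorusSite 4 2 × Fin 3 × Fin 4) (TorusSite 4 2 × Fin 3 × Fin 4) ℂ := wilsonDirac (unitaryFundamentalRep (Fin 3) ℂ) (fun e : Edge 4 2 => u e.2) m 1; let Bz : Matrix (TorusSite 4 2 × Fin 3 × Fin 4) (TorusSite 4 2 × Fin 3 × Fin 4) ℂ := wilsonDirac (unitaryFundamentalRep (Fin 3) ℂ) (fun e : Edge 4 2 => u e.2) 0 1; let Dl : (Edge 4 2 → Matrix (Fin 3) (Fin 3) ℂ) → Matrix (TorusSite 4 2 × Fin 3 × Fin 4) (TorusSite 4 2 × Fin 3 × Fin 4) ℂ := fun E => Matrix.of fun p q => -(1 / 2 : ℂ) * ∑ μ : Fin 4, ((if q.1 = Site.shift p.1 μ then ((1 : Matrix (Fin 4) (Fin 4) ℂ) - euclideanGamma μ) p.2.2 q.2.2 * (((u μ : Matrix.unitaryGroup (Fin 3) ℂ) : Matrix (Fin 3) (Fin 3) ℂ) * E (p.1, μ))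 p.2.1 q.2.1 else 0) + (if p.1 = Site.shift q.1 μ then ((1 : Matrix (Fin 4) (Fin 4) ℂ) + euclideanGamma μ) p.2.2 q.2.2 * (((u μ : Matrix.unitaryGroup (Fin 3) ℂ) : Matrix (Fin 3) (Fin 3) ℂ) * E (q.1, μ))ᴴ p.2.1 q.2.1 else 0)); (∀ v : TorusSite 4 2 × Fin 3 × Fin 4 → ℂ, cm * ∑ i, ‖v i‖ ^ 2 ≤ ∑ i, ‖(Bm.mulVec v) i‖ ^ 2) → (∀ v : TorusSite 4 2 × Fin 3 × Fin 4 → ℂ, c0 * ∑ i, ‖v i‖ ^ 2 ≤ ∑ i, ‖(Bz.mulVec v) i‖ ^ 2) → ∀ Y : Edge 4 2 → Matrix (Fin 3) (Fin 3) ℂ, |((Bm⁻¹ * Dl Y * (Bm⁻¹ * Dl Y)).trace.re / 2 - (Bm⁻¹ * Dl (fun e => Y e * Y e)).trace.re / 2) - ((Bz⁻¹ * Dl Y * (Bz⁻¹ * Dl Y)).trace.re / 2 - (Bz⁻¹ * Dl (fun e => Y e * Y e)).trace.re / 2)| ≤ |m| * (16 / (cm * Real.sqrt c0) + 16 / (c0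 * Real.sqrt cm) + 40 / (Real.sqrt cm * Real.sqrt c0)) * (∑ e : Edge 4 2, ∑ a, ∑ b, ‖Y e a b‖ ^ 2) := by
  intro m u cm c0 hcm hc0 Bm Bz Dl hBm hBz Y
  -- the mass enters only through the diagonal: `B_m = B_z + m · 1`
  have hmass : Bm = Bz + (m : ℂ) • 1 := by
    ext p q
    rw [Matrix.add_apply, Matrix.smul_apply, Matrix.one_apply]
    simp only [Bm, Bz, wilsonDirac, Matrix.of_apply]
    by_cases h : p = q
    · rw [if_pos h, if_pos h, if_pos h, smul_eq_mul]; push_cast; ring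
    · rw [if_neg h, if_neg h, if_neg h, smul_zero, add_zero]
  -- the hopping form `H`: `Δ(E) = H(uE, (uE)ᴴ)`
  obtain ⟨H, hH⟩ : ∃ H : (Fin 4 → TorusSite 4 2 → Matrix (Fin 3) (Fin 3) ℂ) →
      (Fin 4 → TorusSite 4 2 → Matrix (Fin 3) (Fin 3) ℂ) →
        Matrix (TorusSite 4 2 × Fin 3 × Fin 4) (TorusSite 4 2 × Fin 3 × Fin 4) ℂ,
      ∀ Cp Cm, H Cp Cm = Matrix.of fun p q : TorusSite 4 2 × Fin 3 × Fin 4 =>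
        -(1 / 2 : ℂ) * ∑ μ : Fin 4,
          ((if q.1 = Literature.MathematicalPhysics.QuantumFieldTheory.Site.shift p.1 μ then
              ((1 : Matrix (Fin 4) (Fin 4) ℂ) - euclideanGamma μ) p.2.2 q.2.2 * Cp μ p.1 p.2.1 q.2.1
            else 0) +
            (if p.1 = Literature.MathematicalPhysics.QuantumFieldTheory.Site.shift q.1 μ then
              ((1 : Matrix (Fin 4) (Fin 4) ℂ) + euclideanGamma μ) p.2.2 q.2.2 * Cm μ q.1 p.2.1 q.2.1
            else 0)) :=
    ⟨_, fun _ _ => rfl⟩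
  have hDl : ∀ E' : Edge 4 2 → Matrix (Fin 3) (Fin 3) ℂ,
      Dl E' = H (fun μ x => (u μ : Matrix (Fin 3) (Fin 3) ℂ) * E' (x, μ))
        (fun μ y => ((u μ : Matrix (Fin 3) (Fin 3) ℂ) * E' (y, μ))ᴴ) := fun E' => by
    rw [hH]
  -- the Frobenius bound `‖Δ(E)‖_F² ≤ 32 ‖E‖²`
  have hF : ∀ E' : Edge 4 2 → Matrix (Fin 3) (Fin 3) ℂ,
      ∑ p, ∑ q, ‖Dl E' p q‖ ^ 2 ≤ 32 * ∑ e, ∑ a, ∑ b, ‖E' e a b‖ ^ 2 := fun E' => by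
    rw [hDl]
    refine (hop_frob_le hH _ _).trans (le_of_eq ?_)
    simp only [sum_norm_sq_conjTranspose, StubDeltaBounds.sum_norm_sq_unitary_mul]
    rw [sum_edge_eq E', Finset.mul_sum _ _ (2 : ℝ), Finset.mul_sum _ _ (32 : ℝ)]
    exact Finset.sum_congr rfl fun μ _ => by ring
  -- `‖Δ(Y ⋆ Y)‖_F² ≤ 32 (‖Y‖²)²`
  have hF2 : ∑ p, ∑ q, ‖Dl (fun e => Y e * Y e) p q‖ ^ 2 ≤
      32 * (∑ e, ∑ a, ∑ b, ‖Y e a b‖ ^ 2) ^ 2 :=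
    (hF fun e => Y e * Y e).trans
      (mul_le_mul_of_nonneg_left (sum_frob_mul_self_le Y) (by norm_num))
  exact hessian_sub_le Bm Bz (Dl Y) (Dl fun e => Y e * Y e) m hcm hc0 hBm hBz hmass card_index
    (by positivity) (hF Y) hF2

end Summit.QuantumFields.QCD.Cruxes.CriticalLineDiamagnetism.ChessboardCellGain

end
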